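import Literature.AlgebraicGeometry.Motives.AlbaneseRationalCohomology
import HarnessLib

/-!
# Pull-backs of `H¹`-classes from an abelian variety factor through the Albanese variety

Topic `Literature/AlgebraicGeometry/Motives`, sequel of `AlbaneseExistenceComplex` and
`AlbaneseRationalCohomology`. PROOF FILE: theorems only — no definition, no named fact, sorry-free
(D-0026).

Let `X` be a complex scheme with an Albanese datum `𝒥 : Jacobian X` (Milne, *Jacobian Varieties*,
Prop. 6.1/6.4: every pointed morphism `X → A` to an abelian variety factors uniquely through the Albanese
map `f^P : X → J`, the tree's `Jacobian.descPointed`), `A/ℂ` an abelian variety and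
`E ⊆ ℂ ⊗_ℚ H¹(A(ℂ); ℚ)` any subspace (in the applications: an eigenline of a CM action, or `H^{1,0}(A)`).
Liu 2021, proof of Prop. 4.13 / Thm. 4.18 (ll. 2122–2124, 2247–2270 of the arXiv source) reads classes on
a unitary Shimura variety pulled back from CM abelian varieties THROUGH ITS ALBANESE: "`(f^* α)|_{X}` is the
pull-back of `α` along `X → Alb_X → A`" (Lemma 2.4 (1): `H¹(Alb X) ≅ H¹(X)`). This file proves the
dictionary behind that sentence for the tree's carriers:

* `bettiCohomology_baseChange_map_eq_abelJacobi_comp` — for every morphism `F : X → A`,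
  `F^* ⊗ ℂ = ((f^P)^* ⊗ ℂ) ∘ (u^* ⊗ ℂ)` on `ℂ ⊗ H¹(A(ℂ); ℚ)` for the homomorphism `u : J → A` of the
  universal property applied to the translate `F − F(P)` (translations act trivially on `H¹`; the tree's
  `Jacobian.bettiCohomology_map_eq_comp_abelJacobi`);
* **`span_baseChange_pull_eq_map_abelJacobi`** — the span of the classes `(F^* ⊗ ℂ) α`, `F : X → A` any
  morphism, `α ∈ E`, EQUALS the image under `(f^P)^* ⊗ ℂ` of the span of the classes `(u^* ⊗ ℂ) α`,
  `u : J → A` a HOMOMORPHISM, `α ∈ E`;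
* for `X` smooth projective (so that `(f^P)^* ⊗ ℂ` is injective,
  `Jacobian.injective_baseChange_bettiCohomology_map_abelJacobi_one_of_dim`):
  **`span_baseChange_pull_eq_bot_iff`** / **`span_baseChange_pull_ne_bot_iff`** — that span vanishes iff
  every homomorphism `u : J → A` kills `E`, i.e. it is non-zero iff SOME homomorphism `Alb X → A` pulls `E`
  back non-trivially — in particular `Hom(Alb X, A) ≠ 0`
  (`exists_hom_ne_zero_of_span_baseChange_pull_ne_bot`; the zero homomorphism kills `ℂ ⊗ H¹`,
  `AbelianVariety.baseChange_bettiCohomology_map_zero_one`); **`span_baseChange_pull_ne_bot_of_surjective`**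
  — a SURJECTIVE homomorphism `Alb X ↠ A` makes it non-zero as soon as `E ≠ 0` (`u^* ⊗ ℂ` injective,
  Voisin I Lemma 7.28 in the form `AbelianVariety.injective_baseChange_bettiCohomology_map_one_of_surjective`),
  with the explicit non-zero class `((f^P ≫ u)^* ⊗ ℂ) α` (`baseChange_map_abelJacobi_comp_ne_zero`); and
  for SIMPLE `A` and `E ≠ 0` the equivalence **`span_baseChange_pull_ne_bot_iff_exists_hom_ne_zero`**:
  the span is non-zero iff `Hom(Alb X, A) ≠ 0` (non-zero homomorphisms to a simple abelian variety are
  onto, Mumford §19).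

Consumer: the Hodge-CM cell's isotypic blocks `U_Ψ(Γ) ⊆ H¹(P_Γ, ℂ)` of a Picard modular surface
(`Summit.HodgeConjecture.CorCM.Universe.Uiso`: the span of pull-backs of holomorphic `σ`-eigen one-forms
along all morphisms `P_Γ → A_{(K,Ψ)}`), which thereby become statements about `Hom(Alb(P_Γ), A_{(K,Ψ)})`
(Murty–Ramakrishnan 1992; Liu 2021 Cor. 4.20).

## References

* [Liu2021] Y. Liu, *Fourier–Jacobi cycles and arithmetic relative trace formula*, Camb. J. Math. 9
  (2021), Lemma 2.4 (1), proof of Prop. 4.13 (ll. 2122–2124), proof of Thm. 4.18 (eq. (4.2)).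
* [Milne1986JacobianVarieties] J. S. Milne, *Jacobian Varieties* (1986), §6 Prop. 6.1, Prop. 6.4.
* [Badescu2001] L. Bădescu, *Algebraic Surfaces* (2001), Ch. 5 Def. 5.2 (universal property of `Alb`).
* [Voisin2002] C. Voisin, *Hodge Theory and Complex Algebraic Geometry I* (2002), Lemma 7.28.
* [MumfordAV1970] D. Mumford, *Abelian Varieties* (1970), §19 Cor. 2 (homomorphisms to a simple abelian
  variety).
* [LangeBirkenhake1992] H. Lange, Ch. Birkenhake, *Complex Abelian Varieties* (1992), §1.1 (the rational
  representation is additive).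
-/

noncomputable section

open CategoryTheory AlgebraicGeometry
open scoped TensorProduct

namespace Literature.AlgebraicGeometry.Motives

open Literature.AlgebraicGeometry.HodgeTheory

/-! ### The zero homomorphism kills `ℂ ⊗ H¹` -/

/-- **`0^* ⊗ ℂ = 0` on `ℂ ⊗ H¹(B(ℂ); ℚ)`** for the zero homomorphism `0 : A → B` of complex abelian
varieties: the tree's `complexBetti_map_zero_one` (`0^* = 0` on `H¹(−(ℂ); ℂ)`, additivity of the rational
representation) read through the comparison `ℂ ⊗_ℚ H¹(−(ℂ); ℚ) ≅ H¹(−(ℂ); ℂ)`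
(`complexBetti_map_ofRatClassBaseChangeEquiv`). [cite: LangeBirkenhake1992, §1.1 (p. 19)] -/
theorem AbelianVariety.baseChange_bettiCohomology_map_zero_one (A B : AbelianVariety ℂ) :
    (bettiCohomology.map (0 : A ⟶ B).hom.hom.hom 1).hom.baseChange ℂ = 0 := by
  have hA : IsSmoothProjective A.dim A.X := AbelianVariety.isSmoothProjective_holds
  have hB : IsSmoothProjective B.dim B.X := AbelianVariety.isSmoothProjective_holds
  refine LinearMap.ext fun t => (ofRatClassBaseChangeEquiv hA 1).injective ?_
  have h := complexBetti_map_ofRatClassBaseChangeEquiv hA hB (0 : A ⟶ B).hom.hom.hom t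
  rw [complexBetti_map_zero_one] at h
  rw [← h, LinearMap.zero_apply, map_zero]
  rfl

namespace Jacobian

universe u

variable {X : SchemeOver ℂ} (𝒥 : Jacobian X) (P : AlgPoints X ℂ) (A : AbelianVariety ℂ)
  (E : Submodule ℂ (ℂ ⊗[ℚ] bettiCohomology A.X 1))

/-! ### Every morphism to an abelian variety factors on `H¹` through the Albanese map -/

/-- **`F^* ⊗ ℂ = ((f^P)^* ⊗ ℂ) ∘ (u^* ⊗ ℂ)`** on `ℂ ⊗ H¹(A(ℂ); ℚ)`, for every morphism `F : X → A` to an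
abelian variety, `u = descPointed P (F − F(P))` the homomorphism of the universal property (Milne
Prop. 6.1) — translations of `A(ℂ)` act trivially on `H¹`. [cite: Milne1986JacobianVarieties, §6 Prop. 6.1]
[cite: Liu2021, Lemma 2.4 (1) and proof of Prop. 4.13] -/
theorem bettiCohomology_baseChange_map_eq_abelJacobi_comp (F : X ⟶ A.X) :
    (bettiCohomology.map F 1).hom.baseChange ℂ =
      (bettiCohomology.map (𝒥.abelJacobi P) 1).hom.baseChange ℂ ∘ₗ
        (bettiCohomology.map
          (𝒥.descPointed P _ (Jacobian.point_comp_mul_const_inv P F)).hom.hom.hom 1).hom.baseChange ℂ := by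
  rw [← LinearMap.baseChange_comp, ← ModuleCat.hom_comp, ← 𝒥.bettiCohomology_map_eq_comp_abelJacobi P F 1]

/-- `((f^P ≫ u)^* ⊗ ℂ) = ((f^P)^* ⊗ ℂ) ∘ (u^* ⊗ ℂ)` for a homomorphism `u : J → A`. [folklore] -/
private theorem baseChange_map_abelJacobi_comp (u : 𝒥.J ⟶ A) :
    (bettiCohomology.map (𝒥.abelJacobi P ≫ u.hom.hom.hom) 1).hom.baseChange ℂ =
      (bettiCohomology.map (𝒥.abelJacobi P) 1).hom.baseChange ℂ ∘ₗ
        (bettiCohomology.map u.hom.hom.hom 1).hom.baseChange ℂ := by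
  rw [bettiCohomology.map_comp, ModuleCat.hom_comp, LinearMap.baseChange_comp]

/-! ### The span of pull-backs of a subspace `E ⊆ ℂ ⊗ H¹(A)` -/

/-- **The span of the pull-backs `(F^* ⊗ ℂ) α` (`F : X → A` any morphism, `α ∈ E`) is the image under
`(f^P)^* ⊗ ℂ` of the span of the pull-backs `(u^* ⊗ ℂ) α` along HOMOMORPHISMS `u : Alb X → A`**
(`F^* = (f^P)^* ∘ u^*` one way; `f^P ≫ u` is a morphism `X → A` the other way).
[cite: Liu2021, Lemma 2.4 (1) and proof of Thm. 4.18 (eq. (4.2))] [cite: Milne1986JacobianVarieties, §6 Prop. 6.1] -/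
theorem span_baseChange_pull_eq_map_abelJacobi :
    Submodule.span ℂ {ω : ℂ ⊗[ℚ] bettiCohomology X 1 |
        ∃ (F : X ⟶ A.X) (α : ℂ ⊗[ℚ] bettiCohomology A.X 1),
          α ∈ E ∧ ω = (bettiCohomology.map F 1).hom.baseChange ℂ α} =
      (Submodule.span ℂ {β : ℂ ⊗[ℚ] bettiCohomology 𝒥.J.X 1 |
        ∃ (u : 𝒥.J ⟶ A) (α : ℂ ⊗[ℚ] bettiCohomology A.X 1),
          α ∈ E ∧ β = (bettiCohomology.map u.hom.hom.hom 1).hom.baseChange ℂ α}).map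
        ((bettiCohomology.map (𝒥.abelJacobi P) 1).hom.baseChange ℂ) := by
  apply le_antisymm
  · rw [Submodule.span_le]
    rintro _ ⟨F, α, hα, rfl⟩
    rw [𝒥.bettiCohomology_baseChange_map_eq_abelJacobi_comp P A F, LinearMap.comp_apply]
    exact Submodule.mem_map_of_mem (Submodule.subset_span ⟨_, α, hα, rfl⟩)
  · rw [Submodule.map_span_le]
    rintro _ ⟨u, α, hα, rfl⟩
    refine Submodule.subset_span ⟨𝒥.abelJacobi P ≫ u.hom.hom.hom, α, hα, ?_⟩
    rw [𝒥.baseChange_map_abelJacobi_comp P A u, LinearMap.comp_apply]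

/-- Every class in the span of pull-backs from `A` comes from `ℂ ⊗ H¹(Alb X; ℚ)` under `(f^P)^* ⊗ ℂ`.
[cite: Liu2021, Lemma 2.4 (1)] -/
theorem span_baseChange_pull_le_range_abelJacobi :
    Submodule.span ℂ {ω : ℂ ⊗[ℚ] bettiCohomology X 1 |
        ∃ (F : X ⟶ A.X) (α : ℂ ⊗[ℚ] bettiCohomology A.X 1),
          α ∈ E ∧ ω = (bettiCohomology.map F 1).hom.baseChange ℂ α} ≤
      LinearMap.range ((bettiCohomology.map (𝒥.abelJacobi P) 1).hom.baseChange ℂ) := by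
  rw [𝒥.span_baseChange_pull_eq_map_abelJacobi P A E]
  exact LinearMap.map_le_range

/-! ### Smooth projective `X`: `(f^P)^* ⊗ ℂ` is injective, so non-vanishing is read on `Alb X` -/

variable {d : ℕ}

/-- **The span of pull-backs of `E` along all morphisms `X → A` vanishes iff every homomorphism
`u : Alb X → A` kills `E` on `ℂ ⊗ H¹`** (`X` smooth projective, so that `(f^P)^* ⊗ ℂ` is injective).
[cite: Liu2021, Lemma 2.4 (1) and proof of Thm. 4.18] [cite: Badescu2001, Ch. 5 Def. 5.2] -/
theorem span_baseChange_pull_eq_bot_iff (hX : IsSmoothProjective d X) :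
    Submodule.span ℂ {ω : ℂ ⊗[ℚ] bettiCohomology X 1 |
        ∃ (F : X ⟶ A.X) (α : ℂ ⊗[ℚ] bettiCohomology A.X 1),
          α ∈ E ∧ ω = (bettiCohomology.map F 1).hom.baseChange ℂ α} = ⊥ ↔
      ∀ u : 𝒥.J ⟶ A, E.map ((bettiCohomology.map u.hom.hom.hom 1).hom.baseChange ℂ) = ⊥ := by
  obtain ⟨P⟩ := hX.nonempty_algPoints ℂ
  rw [𝒥.span_baseChange_pull_eq_map_abelJacobi P A E, ← le_bot_iff, Submodule.map_le_iff_le_comap,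
    Submodule.comap_bot, LinearMap.ker_eq_bot.2
      (𝒥.injective_baseChange_bettiCohomology_map_abelJacobi_one_of_dim hX P),
    le_bot_iff, Submodule.span_eq_bot]
  constructor
  · intro h u
    rw [Submodule.eq_bot_iff]
    rintro _ ⟨α, hα, rfl⟩
    exact h _ ⟨u, α, hα, rfl⟩
  · rintro h _ ⟨u, α, hα, rfl⟩
    exact (Submodule.eq_bot_iff _).1 (h u) _ (Submodule.mem_map_of_mem hα)

/-- **The span of pull-backs of `E` along all morphisms `X → A` is non-zero iff SOME homomorphism
`u : Alb X → A` pulls `E` back non-trivially.** [cite: Liu2021, Lemma 2.4 (1) and proof of Thm. 4.18]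
[cite: Badescu2001, Ch. 5 Def. 5.2] -/
theorem span_baseChange_pull_ne_bot_iff (hX : IsSmoothProjective d X) :
    Submodule.span ℂ {ω : ℂ ⊗[ℚ] bettiCohomology X 1 |
        ∃ (F : X ⟶ A.X) (α : ℂ ⊗[ℚ] bettiCohomology A.X 1),
          α ∈ E ∧ ω = (bettiCohomology.map F 1).hom.baseChange ℂ α} ≠ ⊥ ↔
      ∃ u : 𝒥.J ⟶ A, E.map ((bettiCohomology.map u.hom.hom.hom 1).hom.baseChange ℂ) ≠ ⊥ := by
  rw [Ne, 𝒥.span_baseChange_pull_eq_bot_iff A E hX, not_forall]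

/-- **If the span of pull-backs of `E` along all morphisms `X → A` is non-zero, then
`Hom(Alb X, A) ≠ 0`** (`X` smooth projective): the zero homomorphism kills `ℂ ⊗ H¹`
(`AbelianVariety.baseChange_bettiCohomology_map_zero_one`). [cite: Liu2021, Lemma 2.4 (1) and Cor. 4.20] -/
theorem exists_hom_ne_zero_of_span_baseChange_pull_ne_bot (hX : IsSmoothProjective d X)
    (h : Submodule.span ℂ {ω : ℂ ⊗[ℚ] bettiCohomology X 1 |
        ∃ (F : X ⟶ A.X) (α : ℂ ⊗[ℚ] bettiCohomology A.X 1),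
          α ∈ E ∧ ω = (bettiCohomology.map F 1).hom.baseChange ℂ α} ≠ ⊥) :
    ∃ u : 𝒥.J ⟶ A, u ≠ 0 := by
  obtain ⟨u, hu⟩ := (𝒥.span_baseChange_pull_ne_bot_iff A E hX).1 h
  refine ⟨u, fun h0 => hu ?_⟩
  rw [h0, AbelianVariety.baseChange_bettiCohomology_map_zero_one, Submodule.map_zero]

/-- **`((f^P ≫ u)^* ⊗ ℂ) α ≠ 0` for a SURJECTIVE homomorphism `u : Alb X ↠ A` and `α ≠ 0`** (`X` smooth
projective): `(f^P)^* ⊗ ℂ` and `u^* ⊗ ℂ` are both injective (Voisin I Lemma 7.28).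
[cite: Voisin2002, Lemma 7.28] [cite: Liu2021, Lemma 2.4 (1)] -/
theorem baseChange_map_abelJacobi_comp_ne_zero (hX : IsSmoothProjective d X) (u : 𝒥.J ⟶ A)
    [Surjective (AbelianVariety.Hom.toSchemeHom u)] {α : ℂ ⊗[ℚ] bettiCohomology A.X 1} (hα : α ≠ 0) :
    (bettiCohomology.map (𝒥.abelJacobi P ≫ u.hom.hom.hom) 1).hom.baseChange ℂ α ≠ 0 := by
  rw [𝒥.baseChange_map_abelJacobi_comp P A u, LinearMap.comp_apply]
  intro h
  have h1 := 𝒥.injective_baseChange_bettiCohomology_map_abelJacobi_one_of_dim hX P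
    (h.trans (map_zero _).symm)
  exact hα (AbelianVariety.injective_baseChange_bettiCohomology_map_one_of_surjective u
    (h1.trans (map_zero _).symm))

/-- The class `((f^P ≫ u)^* ⊗ ℂ) α`, `α ∈ E`, lies in the span of pull-backs of `E` (it IS a generator).
[folklore] -/
private theorem baseChange_map_abelJacobi_comp_mem_span (u : 𝒥.J ⟶ A)
    {α : ℂ ⊗[ℚ] bettiCohomology A.X 1} (hα : α ∈ E) :
    (bettiCohomology.map (𝒥.abelJacobi P ≫ u.hom.hom.hom) 1).hom.baseChange ℂ α ∈
      Submodule.span ℂ {ω : ℂ ⊗[ℚ] bettiCohomology X 1 |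
        ∃ (F : X ⟶ A.X) (α : ℂ ⊗[ℚ] bettiCohomology A.X 1),
          α ∈ E ∧ ω = (bettiCohomology.map F 1).hom.baseChange ℂ α} :=
  Submodule.subset_span ⟨_, α, hα, rfl⟩

/-- **A SURJECTIVE homomorphism `Alb X ↠ A` makes the span of pull-backs of `E` non-zero as soon as
`E ≠ 0`** (`X` smooth projective). In the Hodge-CM application: if `A_{(K,Ψ)}` is a quotient of
`Alb(P_Γ)` then `P_Γ` carries non-zero `B_Ψ`-isotypic `σ`-eigen one-forms for every `σ ∈ Ψ`
(Murty–Ramakrishnan; Liu 2021 Cor. 4.20 supplies such quotients). [cite: Liu2021, Lemma 2.4 (1) and Cor. 4.20]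
[cite: Voisin2002, Lemma 7.28] -/
theorem span_baseChange_pull_ne_bot_of_surjective (hX : IsSmoothProjective d X) (u : 𝒥.J ⟶ A)
    [Surjective (AbelianVariety.Hom.toSchemeHom u)] (hE : E ≠ ⊥) :
    Submodule.span ℂ {ω : ℂ ⊗[ℚ] bettiCohomology X 1 |
        ∃ (F : X ⟶ A.X) (α : ℂ ⊗[ℚ] bettiCohomology A.X 1),
          α ∈ E ∧ ω = (bettiCohomology.map F 1).hom.baseChange ℂ α} ≠ ⊥ := by
  obtain ⟨P⟩ := hX.nonempty_algPoints ℂ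
  obtain ⟨α, hαE, hα0⟩ := (Submodule.ne_bot_iff E).1 hE
  rw [Submodule.ne_bot_iff]
  exact ⟨_, 𝒥.baseChange_map_abelJacobi_comp_mem_span P A E u hαE,
    𝒥.baseChange_map_abelJacobi_comp_ne_zero P A hX u hα0⟩

/-- **For a SIMPLE abelian variety `A` and `E ≠ 0`, the span of pull-backs of `E` along all morphisms
`X → A` is non-zero iff `Hom(Alb X, A) ≠ 0`** (`X` smooth projective): a non-zero homomorphism to a simple
abelian variety is onto (Mumford §19, the tree's `AbelianVariety.surjective_of_isSimple`), and an onto one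
pulls `E` back injectively. In the Hodge-CM application (`A = A_{(K,Ψ)}` with `Ψ` primitive, `E` the
holomorphic `σ`-eigenline): «`P_Γ` carries a non-zero `B_Ψ`-isotypic `σ`-eigen one-form» iff
«`Hom(Alb(P_Γ), A_{(K,Ψ)}) ≠ 0`» (Murty–Ramakrishnan; Liu 2021 Cor. 4.20).
[cite: Liu2021, Lemma 2.4 (1) and Cor. 4.20] [cite: MumfordAV1970, §19 Cor. 2] [cite: Voisin2002, Lemma 7.28] -/
theorem span_baseChange_pull_ne_bot_iff_exists_hom_ne_zero (hX : IsSmoothProjective d X)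
    (hA : A.IsSimple) (hE : E ≠ ⊥) :
    Submodule.span ℂ {ω : ℂ ⊗[ℚ] bettiCohomology X 1 |
        ∃ (F : X ⟶ A.X) (α : ℂ ⊗[ℚ] bettiCohomology A.X 1),
          α ∈ E ∧ ω = (bettiCohomology.map F 1).hom.baseChange ℂ α} ≠ ⊥ ↔
      ∃ u : 𝒥.J ⟶ A, u ≠ 0 :=
  ⟨𝒥.exists_hom_ne_zero_of_span_baseChange_pull_ne_bot A E hX, fun ⟨u, hu⟩ =>
    haveI := AbelianVariety.surjective_of_isSimple u hA hu
    𝒥.span_baseChange_pull_ne_bot_of_surjective A E hX u hE⟩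

end Jacobian

end Literature.AlgebraicGeometry.Motives

end
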